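import Summits.RiemannHypothesis.RiemannHypothesis.Theorems.SignConeConeMagnificationTranslate
import Summits.RiemannHypothesis.RiemannHypothesis.Theorems.SignConeConeMagnificationSeries

/-!
# `ConeMagnification`: the continuation `D_c(s) M_G(s) - M_G(1)/(s-1)` for unit-slack weights
(route `SignCone`, item stmt-RiemannHypothesis-16303; HELPER file, `--supports`)

For a weight `c ≥ 0` with unit slack against EVERY Weil test, a Weil test `g` supported in `[-a, a]` and its
autocorrelation `G = g ⋆ g̃` (supported in `[-2a, 2a]`, bounded by `M`), put
`u(x) := P_c(G(· - x)) - e^{x/2} M_G(1)` (`M_G = weilMellin G`). Then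

* `norm_weilArchTerm_weilTranslate_le` — the archimedean term of a translate is bounded:
  `‖W_∞(G(· - x))‖ ≤ (1/2π) ∫ |Ĝ(t) Re ψ(1/4 + it/2)| dt + ‖G(-x)‖ log π`;
* `norm_fakeSum_translate_sub_le` — `‖u(x)‖ ≤ B` for `x ≥ 0`: `P_c(G(·-x)) = W_ar(G(·-x)) + G(-x) - Φ_c(G(·-x))`
  with `Φ_c` bounded on translates (`norm_fakeForm_weilTranslate_le`), `W_ar = e^{-x/2}M_G(0) + e^{x/2}M_G(1) + W_∞`;
* `LSeries_mul_weilMellin_sub_pole_eq` — for `Re z > 1/2` with `Σ c(n) n^{-(Re z + 1/2)} < ∞`: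
  `D_c(z + 1/2) M_G(z + 1/2) - M_G(1)/(z - 1/2) = ∫₀^∞ u(x) e^{-zx} dx - Fin(z)` (`LSeries_mul_transform_eq`,
  `integral_exp_half_laplace`), and the right side is HOLOMORPHIC on `Re z > 0`
  (`differentiableOn_contRHS`: `differentiableOn_laplace`, `differentiableOn_finCorrection`).

So `s ↦ D_c(s) M_G(s) - M_G(1)/(s-1)` continues analytically from `Re s > x₀` to `Re s > 1/2`; division by
`M_G` on thin rectangles (next file) yields the continuation input of the Landau transfer.
-/

noncomputable section

-- `Summit.RiemannHypothesis.RiemannHypothesis.…` repeats a namespace component by design (D-0017 layout).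
set_option linter.dupNamespace false

open scoped BigOperators ComplexConjugate Real
open Complex MeasureTheory Set Filter Metric Topology LSeries

namespace Summit.RiemannHypothesis.RiemannHypothesis.Theorems.SignCone

open Literature.NumberTheory.LFunctions
open Summit.RiemannHypothesis.RiemannHypothesis.Theorems.RuelleBandCofiniteCriticalLine

/-! ## The polar and archimedean terms of a translate -/

/-- `weilPolarTerm (K(· - x)) = e^{-x/2} K̂(0) + e^{x/2} K̂(1)` (`weilMellin_weilTranslate`). [folklore] -/
theorem weilPolarTerm_weilTranslate (K : ℝ → ℂ) (x : ℝ) :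
    weilPolarTerm (weilTranslate K x) = cexp (-((x : ℂ) / 2)) * weilMellin K 0 + cexp ((x : ℂ) / 2) * weilMellin K 1 := by
  unfold weilPolarTerm
  rw [weilMellin_weilTranslate, weilMellin_weilTranslate]
  congr 2
  · congr 1; ring
  · congr 1; ring

/-- **The archimedean term is bounded along translates**: for a Weil test `K`,
`‖W_∞(K(· - x))‖ ≤ (1/2π) ∫ ‖K̂(1/2+it) Re ψ(1/4+it/2)‖ dt + ‖K(-x)‖ log π`
(`(K(· - x))^(1/2 + it) = e^{itx} K̂(1/2 + it)` has the same modulus). [folklore] -/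
theorem norm_weilArchTerm_weilTranslate_le {K : ℝ → ℂ} (hK : IsWeilTest K) (x : ℝ) :
    ‖weilArchTerm (weilTranslate K x)‖ ≤
      1 / (2 * π) * (∫ t : ℝ, ‖weilMellin K (1 / 2 + t * I) * ((Complex.digamma (1 / 4 + t / 2 * I)).re : ℂ)‖) +
        ‖K (-x)‖ * Real.log π := by
  have hint := stub_branchesContinuous_integrable_weilArchIntegrand hK
  have hAI : ‖weilArchIntegral (weilTranslate K x)‖ ≤
      ∫ t : ℝ, ‖weilMellin K (1 / 2 + t * I) * ((Complex.digamma (1 / 4 + t / 2 * I)).re : ℂ)‖ := by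
    unfold weilArchIntegral
    refine (norm_integral_le_integral_norm _).trans (le_of_eq ?_)
    congr 1 with t
    rw [weilMellin_weilTranslate, mul_assoc, norm_mul, Complex.norm_exp]
    have : ((1 / 2 + (t : ℂ) * I - 1 / 2) * (x : ℂ)).re = 0 := by
      simp [mul_re]
    rw [this, Real.exp_zero, one_mul]
  have hpi : 0 < 1 / (2 * π) := by positivity
  unfold weilArchTerm
  refine (norm_sub_le _ _).trans (add_le_add ?_ ?_)
  · rw [norm_mul, show ‖(1 / (2 * π) : ℂ)‖ = 1 / (2 * π) by
      rw [show (1 / (2 * π) : ℂ) = ((1 / (2 * π) : ℝ) : ℂ) by push_cast; ring, Complex.norm_real,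
        Real.norm_of_nonneg hpi.le]]
    exact mul_le_mul_of_nonneg_left hAI hpi.le
  · rw [norm_mul, show ‖(Real.log π : ℂ)‖ = Real.log π by
      rw [Complex.norm_real, Real.norm_of_nonneg (Real.log_nonneg (by linarith [Real.pi_gt_three]))]]
    simp [weilTranslate]

/-! ## The bounded function `u(x) = P_c(G(· - x)) - e^{x/2} M_G(1)` -/

variable {g : ℝ → ℂ} {a : ℝ} {c : ℕ → ℝ}

/-- **`u` is bounded on `x ≥ 0`.** For `c` with unit slack against every Weil test, a Weil test `g` and
`G = g ⋆ g̃` with `‖G‖ ≤ M`: for `x ≥ 0`,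
`‖P_c(G(· - x)) - e^{x/2} M_G(1)‖ ≤ ‖M_G(0)‖ + (1/2π)∫‖Ĝ Re ψ‖ + M log π + M + Re Φ_c(G)`. [folklore] -/
theorem norm_fakeSum_translate_sub_le
    (hU : ∀ φ : ℝ → ℂ, IsWeilTest φ →
      -(∫ t, ‖φ t‖ ^ 2) ≤
        (weilPolarTerm (weilConv φ (weilReflect φ)) + weilArchTerm (weilConv φ (weilReflect φ)) -
          ∑' n : ℕ, ((c n : ℝ) : ℂ) / (Real.sqrt n : ℂ) *
            (weilConv φ (weilReflect φ) (Real.log n) + weilConv φ (weilReflect φ) (-Real.log n))).re)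
    (hg : IsWeilTest g) {M : ℝ} (hM : ∀ v, ‖weilConv g (weilReflect g) v‖ ≤ M) {x : ℝ} (hx : 0 ≤ x) :
    ‖(∑' n : ℕ, ((c n : ℝ) : ℂ) / (Real.sqrt n : ℂ) *
        (weilConv g (weilReflect g) (Real.log n - x) + weilConv g (weilReflect g) (-Real.log n - x))) -
        cexp ((x : ℂ) / 2) * weilMellin (weilConv g (weilReflect g)) 1‖ ≤
      ‖weilMellin (weilConv g (weilReflect g)) 0‖ +
        1 / (2 * π) * (∫ t : ℝ, ‖weilMellin (weilConv g (weilReflect g)) (1 / 2 + t * I) *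
          ((Complex.digamma (1 / 4 + t / 2 * I)).re : ℂ)‖) + M * Real.log π + M +
        (weilPolarTerm (weilConv g (weilReflect g)) + weilArchTerm (weilConv g (weilReflect g)) -
          (∑' n : ℕ, ((c n : ℝ) : ℂ) / (Real.sqrt n : ℂ) *
            (weilConv g (weilReflect g) (Real.log n) + weilConv g (weilReflect g) (-Real.log n))) +
          weilConv g (weilReflect g) 0).re := by
  set G := weilConv g (weilReflect g) with hG
  have hGt : IsWeilTest G := hg.weilConv hg.weilReflect
  set T := weilTranslate G x with hT
  set E : ℂ := weilPolarTerm T + weilArchTerm T -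
    (∑' n : ℕ, ((c n : ℝ) : ℂ) / (Real.sqrt n : ℂ) * (T (Real.log n) + T (-Real.log n))) + T 0 with hE
  have hEb := norm_fakeForm_weilTranslate_le hU hg x
  -- `P_c(T) = polar + arch + T(0) - E`
  have hP : (∑' n : ℕ, ((c n : ℝ) : ℂ) / (Real.sqrt n : ℂ) * (G (Real.log n - x) + G (-Real.log n - x))) =
      weilPolarTerm T + weilArchTerm T + T 0 - E := by
    simp only [hE, hT, weilTranslate]
    ring
  have hT0 : T 0 = G (-x) := by simp [hT, weilTranslate]
  rw [hP, weilPolarTerm_weilTranslate, hT0]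
  have hM0 : 0 ≤ M := (norm_nonneg _).trans (hM 0)
  have hA := norm_weilArchTerm_weilTranslate_le hGt x
  have hlogπ : 0 ≤ Real.log π := Real.log_nonneg (by linarith [Real.pi_gt_three])
  have hex : ‖cexp (-((x : ℂ) / 2)) * weilMellin G 0‖ ≤ ‖weilMellin G 0‖ := by
    rw [norm_mul, Complex.norm_exp]
    have : (-((x : ℂ) / 2)).re = -(x / 2) := by simp
    rw [this]
    exact mul_le_of_le_one_left (norm_nonneg _) (Real.exp_le_one_iff.2 (by linarith))
  calc ‖cexp (-((x : ℂ) / 2)) * weilMellin G 0 + cexp ((x : ℂ) / 2) * weilMellin G 1 + weilArchTerm T + G (-x) - E -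
        cexp ((x : ℂ) / 2) * weilMellin G 1‖
      = ‖cexp (-((x : ℂ) / 2)) * weilMellin G 0 + weilArchTerm T + G (-x) + (-E)‖ := by
        congr 1; ring
    _ ≤ ‖cexp (-((x : ℂ) / 2)) * weilMellin G 0‖ + ‖weilArchTerm T‖ + ‖G (-x)‖ + ‖-E‖ :=
        norm_add₄_le
    _ ≤ ‖weilMellin G 0‖ + (1 / (2 * π) * (∫ t : ℝ, ‖weilMellin G (1 / 2 + t * I) *
          ((Complex.digamma (1 / 4 + t / 2 * I)).re : ℂ)‖) + ‖G (-x)‖ * Real.log π) + M +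
          (weilPolarTerm G + weilArchTerm G -
            (∑' n : ℕ, ((c n : ℝ) : ℂ) / (Real.sqrt n : ℂ) * (G (Real.log n) + G (-Real.log n))) + G 0).re := by
        rw [norm_neg]
        exact add_le_add (add_le_add (add_le_add hex hA) (hM _)) hEb
    _ ≤ _ := by nlinarith [hM (-x), norm_nonneg (G (-x))]

/-- `u` is continuous. [folklore] -/
theorem continuous_fakeSum_translate_sub (hg : IsWeilTest g) (hsupp : tsupport g ⊆ Icc (-a) a)
    (c : ℕ → ℝ) :
    Continuous fun x : ℝ => (∑' n : ℕ, ((c n : ℝ) : ℂ) / (Real.sqrt n : ℂ) *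
        (weilConv g (weilReflect g) (Real.log n - x) + weilConv g (weilReflect g) (-Real.log n - x))) -
        cexp ((x : ℂ) / 2) * weilMellin (weilConv g (weilReflect g)) 1 := by
  have hGt : IsWeilTest (weilConv g (weilReflect g)) := hg.weilConv hg.weilReflect
  refine (continuous_fakeSum_translate hGt.1.continuous
    (fun v hv => Literature.NumberTheory.LFunctions.weilConv_weilReflect_eq_zero_of_le_abs hg hsupp hv) c).sub ?_
  fun_prop

/-! ## The identity and the holomorphy of its right-hand side -/

/-- `Ǧ(z) = ∫ G(v) e^{zv} dv = M_G(z + 1/2)`. [folklore] -/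
theorem integral_mul_exp_eq_weilMellin (G : ℝ → ℂ) (z : ℂ) :
    ∫ v : ℝ, G v * cexp (z * v) = weilMellin G (z + 1 / 2) := by
  unfold weilMellin
  congr 1 with v
  congr 2
  ring

/-- `u · e^{-zx}` is integrable on `(0, ∞)` for `Re z > 0` (bounded continuous `u`). [folklore] -/
theorem integrableOn_mul_exp_of_bounded {u : ℝ → ℂ} (hu : Continuous u) {C : ℝ}
    (hC : ∀ x : ℝ, 0 ≤ x → ‖u x‖ ≤ C) {z : ℂ} (hz : 0 < z.re) :
    IntegrableOn (fun x : ℝ => u x * cexp (-(z * x))) (Ioi 0) := by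
  have hi := (exp_neg_integrableOn_Ioi 0 hz).const_mul C
  simp only [neg_mul] at hi
  refine Integrable.mono' hi (by fun_prop : Continuous fun x : ℝ => u x * cexp (-(z * x))).aestronglyMeasurable ?_
  refine (ae_restrict_iff' measurableSet_Ioi).2 (Eventually.of_forall fun x hx => ?_)
  rw [norm_mul, Complex.norm_exp]
  have : (-(z * (x : ℂ))).re = -(z.re * x) := by simp [mul_re]
  rw [this]
  exact mul_le_mul_of_nonneg_right (hC x (le_of_lt hx)) (Real.exp_pos _).le

/-- **The continuation identity.** Let `c ≥ 0` have unit slack against every Weil test, `g` a Weil test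
with `tsupport g ⊆ [-a, a]` (`a ≥ 0`), `G = g ⋆ g̃`. For `Re z > 1/2` with `Σ c(n) n^{-(Re z + 1/2)} < ∞`:
`D_c(z + 1/2) M_G(z + 1/2) - M_G(1)/(z - 1/2) = ∫₀^∞ u(x) e^{-zx} dx - Fin(z)`, where
`u(x) = P_c(G(· - x)) - e^{x/2} M_G(1)` and `Fin` is the finite correction of `LSeries_mul_transform_eq`
(`N₀ = ⌊e^{2a}⌋ + 1` terms). [folklore] -/
theorem LSeries_mul_weilMellin_sub_pole_eq
    (hU : ∀ φ : ℝ → ℂ, IsWeilTest φ →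
      -(∫ t, ‖φ t‖ ^ 2) ≤
        (weilPolarTerm (weilConv φ (weilReflect φ)) + weilArchTerm (weilConv φ (weilReflect φ)) -
          ∑' n : ℕ, ((c n : ℝ) : ℂ) / (Real.sqrt n : ℂ) *
            (weilConv φ (weilReflect φ) (Real.log n) + weilConv φ (weilReflect φ) (-Real.log n))).re)
    (hc : ∀ n, 0 ≤ c n) (hg : IsWeilTest g) (ha : 0 ≤ a) (hsupp : tsupport g ⊆ Icc (-a) a)
    {z : ℂ} (hz : 1 / 2 < z.re)
    (hsum : LSeriesSummable (fun n => ((c n : ℝ) : ℂ)) ((z.re + 1 / 2 : ℝ) : ℂ)) :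
    LSeries (fun n => ((c n : ℝ) : ℂ)) (z + 1 / 2) * weilMellin (weilConv g (weilReflect g)) (z + 1 / 2) -
        weilMellin (weilConv g (weilReflect g)) 1 / (z - 1 / 2) =
      (∫ x in Ioi (0 : ℝ), ((∑' n : ℕ, ((c n : ℝ) : ℂ) / (Real.sqrt n : ℂ) *
        (weilConv g (weilReflect g) (Real.log n - x) + weilConv g (weilReflect g) (-Real.log n - x))) -
          cexp ((x : ℂ) / 2) * weilMellin (weilConv g (weilReflect g)) 1) * cexp (-(z * x))) -
      ∑ n ∈ Finset.range (⌊Real.exp (2 * a)⌋₊ + 1), ((c n : ℝ) : ℂ) / (Real.sqrt n : ℂ) *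
        ((∫ x in Ioi (0 : ℝ), (weilConv g (weilReflect g) (Real.log n - x) +
            weilConv g (weilReflect g) (-Real.log n - x)) * cexp (-(z * x))) -
          cexp (-(z * Real.log n)) * weilMellin (weilConv g (weilReflect g)) (z + 1 / 2)) := by
  set G := weilConv g (weilReflect g) with hG
  have hGt : IsWeilTest G := hg.weilConv hg.weilReflect
  have hGs : ∀ v : ℝ, 2 * a ≤ |v| → G v = 0 := fun v hv =>
    Literature.NumberTheory.LFunctions.weilConv_weilReflect_eq_zero_of_le_abs hg hsupp hv
  obtain ⟨M, hM⟩ := hGt.1.continuous.bounded_above_of_compact_support hGt.2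
  have hz0 : 0 ≤ z.re := by linarith
  have hz0' : 0 < z.re := by linarith
  have hmain := LSeries_mul_transform_eq hGt.1.continuous hGs (by linarith) hM hc hz0 hsum
  rw [integral_mul_exp_eq_weilMellin] at hmain
  -- split `P = u + e^{x/2} M_G(1)` inside the Laplace integral
  set u : ℝ → ℂ := fun x => (∑' n : ℕ, ((c n : ℝ) : ℂ) / (Real.sqrt n : ℂ) *
      (G (Real.log n - x) + G (-Real.log n - x))) - cexp ((x : ℂ) / 2) * weilMellin G 1 with hu
  have hB : ∀ x : ℝ, 0 ≤ x → ‖u x‖ ≤ ‖weilMellin G 0‖ +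
      1 / (2 * π) * (∫ t : ℝ, ‖weilMellin G (1 / 2 + t * I) * ((Complex.digamma (1 / 4 + t / 2 * I)).re : ℂ)‖) +
      M * Real.log π + M +
      (weilPolarTerm G + weilArchTerm G -
        (∑' n : ℕ, ((c n : ℝ) : ℂ) / (Real.sqrt n : ℂ) * (G (Real.log n) + G (-Real.log n))) + G 0).re :=
    fun x hx => @norm_fakeSum_translate_sub_le g c hU hg M hM x hx
  have huc : Continuous u := @continuous_fakeSum_translate_sub g a hg hsupp c
  have hui : IntegrableOn (fun x : ℝ => u x * cexp (-(z * x))) (Ioi 0) :=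
    integrableOn_mul_exp_of_bounded huc hB hz0'
  have hei : IntegrableOn (fun x : ℝ => cexp ((x : ℂ) / 2) * weilMellin G 1 * cexp (-(z * x))) (Ioi 0) := by
    have ha' : ((1 / 2 : ℂ) - z).re < 0 := by
      simp only [sub_re, one_div]
      norm_num
      linarith
    have h : IntegrableOn (fun x : ℝ => cexp ((1 / 2 - z) * x) * weilMellin G 1) (Ioi 0) :=
      (integrableOn_exp_mul_complex_Ioi ha' 0).mul_const _
    refine h.congr_fun (fun x _ => ?_) measurableSet_Ioi
    show cexp ((1 / 2 - z) * x) * weilMellin G 1 = cexp ((x : ℂ) / 2) * weilMellin G 1 * cexp (-(z * x))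
    rw [show ((1 / 2 : ℂ) - z) * x = (x : ℂ) / 2 + -(z * x) by ring, Complex.exp_add]
    ring
  have hsplit : (∫ x in Ioi (0 : ℝ), (∑' n : ℕ, ((c n : ℝ) : ℂ) / (Real.sqrt n : ℂ) *
      (G (Real.log n - x) + G (-Real.log n - x))) * cexp (-(z * x))) =
      (∫ x in Ioi (0 : ℝ), u x * cexp (-(z * x))) + weilMellin G 1 / (z - 1 / 2) := by
    have e : (fun x : ℝ => (∑' n : ℕ, ((c n : ℝ) : ℂ) / (Real.sqrt n : ℂ) *
        (G (Real.log n - x) + G (-Real.log n - x))) * cexp (-(z * x))) =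
        fun x : ℝ => u x * cexp (-(z * x)) + cexp ((x : ℂ) / 2) * weilMellin G 1 * cexp (-(z * x)) := by
      funext x; simp only [hu]; ring
    rw [e, integral_add hui hei]
    congr 1
    have e2 : (fun x : ℝ => cexp ((x : ℂ) / 2) * weilMellin G 1 * cexp (-(z * x))) =
        fun x : ℝ => weilMellin G 1 * (cexp ((x : ℂ) / 2) * cexp (-(z * x))) := by
      funext x; ring
    rw [e2, integral_const_mul, integral_exp_half_laplace hz]
    ring
  rw [hsplit] at hmain
  show LSeries (fun n => ((c n : ℝ) : ℂ)) (z + 1 / 2) * weilMellin G (z + 1 / 2) - weilMellin G 1 / (z - 1 / 2) =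
    (∫ x in Ioi (0 : ℝ), u x * cexp (-(z * x))) -
      ∑ n ∈ Finset.range (⌊Real.exp (2 * a)⌋₊ + 1), ((c n : ℝ) : ℂ) / (Real.sqrt n : ℂ) *
        ((∫ x in Ioi (0 : ℝ), (G (Real.log n - x) + G (-Real.log n - x)) * cexp (-(z * x))) -
          cexp (-(z * Real.log n)) * weilMellin G (z + 1 / 2))
  rw [sub_eq_iff_eq_add, hmain]
  ring

/-- **The right-hand side is holomorphic on `Re z > 0`.** [folklore] -/
theorem differentiableOn_contRHS
    (hU : ∀ φ : ℝ → ℂ, IsWeilTest φ →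
      -(∫ t, ‖φ t‖ ^ 2) ≤
        (weilPolarTerm (weilConv φ (weilReflect φ)) + weilArchTerm (weilConv φ (weilReflect φ)) -
          ∑' n : ℕ, ((c n : ℝ) : ℂ) / (Real.sqrt n : ℂ) *
            (weilConv φ (weilReflect φ) (Real.log n) + weilConv φ (weilReflect φ) (-Real.log n))).re)
    (hg : IsWeilTest g) (hsupp : tsupport g ⊆ Icc (-a) a) (N : ℕ) :
    DifferentiableOn ℂ (fun z : ℂ =>
      (∫ x in Ioi (0 : ℝ), ((∑' n : ℕ, ((c n : ℝ) : ℂ) / (Real.sqrt n : ℂ) *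
        (weilConv g (weilReflect g) (Real.log n - x) + weilConv g (weilReflect g) (-Real.log n - x))) -
          cexp ((x : ℂ) / 2) * weilMellin (weilConv g (weilReflect g)) 1) * cexp (-(z * x))) -
      ∑ n ∈ Finset.range N, ((c n : ℝ) : ℂ) / (Real.sqrt n : ℂ) *
        ((∫ x in Ioi (0 : ℝ), (weilConv g (weilReflect g) (Real.log n - x) +
            weilConv g (weilReflect g) (-Real.log n - x)) * cexp (-(z * x))) -
          cexp (-(z * Real.log n)) * weilMellin (weilConv g (weilReflect g)) (z + 1 / 2)))
      {z : ℂ | 0 < z.re} := by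
  set G := weilConv g (weilReflect g) with hG
  have hGt : IsWeilTest G := hg.weilConv hg.weilReflect
  have hGs : ∀ v : ℝ, 2 * a ≤ |v| → G v = 0 := fun v hv =>
    Literature.NumberTheory.LFunctions.weilConv_weilReflect_eq_zero_of_le_abs hg hsupp hv
  obtain ⟨M, hM⟩ := hGt.1.continuous.bounded_above_of_compact_support hGt.2
  have hMG : Differentiable ℂ (fun z : ℂ => weilMellin G (z + 1 / 2)) :=
    (differentiable_weilMellin hGt.1.continuous hGt.2).comp (differentiable_id.add_const _)
  have hFin := differentiableOn_finCorrection hGt.1.continuous hGs hM c N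
    (by simp_rw [integral_mul_exp_eq_weilMellin]; exact hMG.differentiableOn)
  simp_rw [integral_mul_exp_eq_weilMellin] at hFin
  refine DifferentiableOn.sub ?_ hFin
  have hB : ∀ x : ℝ, 0 ≤ x → ‖(∑' n : ℕ, ((c n : ℝ) : ℂ) / (Real.sqrt n : ℂ) *
      (G (Real.log n - x) + G (-Real.log n - x))) - cexp ((x : ℂ) / 2) * weilMellin G 1‖ ≤ ‖weilMellin G 0‖ +
      1 / (2 * π) * (∫ t : ℝ, ‖weilMellin G (1 / 2 + t * I) * ((Complex.digamma (1 / 4 + t / 2 * I)).re : ℂ)‖) +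
      M * Real.log π + M +
      (weilPolarTerm G + weilArchTerm G -
        (∑' n : ℕ, ((c n : ℝ) : ℂ) / (Real.sqrt n : ℂ) * (G (Real.log n) + G (-Real.log n))) + G 0).re :=
    fun x hx => @norm_fakeSum_translate_sub_le g c hU hg M hM x hx
  exact differentiableOn_laplace (@continuous_fakeSum_translate_sub g a hg hsupp c) hB

end Summit.RiemannHypothesis.RiemannHypothesis.Theorems.SignCone

end
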